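import Mathlib
import Summits.MatrixMultiplication.Statement
import Summits.MatrixMultiplication.MatrixMultiplication.Theorems.GraphEquationsFreeDial

/-!
# The free dial collapses: `¬ FreeReach D r K` for every `D ≥ 4`, `r`, `K` (lens 5, g50, M85)

Helper for `Summit.MatrixMultiplication.MatrixMultiplication.Theses.GraphEquations.MultiplicityReduction`
(stmt-27806).  M84 (`GraphEquationsFreeDial`) typed the FREE MIXED DIAL `FreeReach D r K` of NODE-g49 §3.1 (words in
the horizontal letters `X_{U,V}` and the LEGAL CONSTANT vertical letters `D_γ`, all cost-free) and calibrated it by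
powers.  This file DECIDES THE WHOLE DIAL: it is identically false from degree `4` on, for every `r` and `K`.

The specimen `CS_n` (degree `4`, `n ≥ 3`, positions `(i, m)` = (row, column)): the LEAF `ℓ = (n-1, 0)` carries the
theta row of row `0`, `t_ℓ = f_ℓ + Σ_m a_{(0,m)} b_{(0,m)} f_{(0,m)}`; every other position of row `≥ 1` is a SQUARE
SLAVE of the position above it, `t_{(i,m)} = f_{(i,m)} + f_{(i-1,m)}²`; the slots of row `0` hold the PINS
`f_{(n-2,m)}²`.  CORRECT (`eval_generator_eq_zero_of_cTest`): pins kill row `n - 2`, slaves propagate vanishing down to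
row `0` and up to row `n - 1`, the leaf then reads `f_ℓ = 0`.  CERTIFICATE: `X_{U,V}` kills slaves, pins, `f_ℓ` and
derives rows (M84 `hDer_rowTest`), so every free stage lies in `CGood R' = {0, slaves, pins} ∪ {row(ρ) : ρ ∈ R'}`,
`|R'| ≤ 2^{length}` rows supported on row `0` and the leaf (`freeTowerSet_subset_cGood`); a constant `D_γ` legal at a
stage containing the specimen has `γ = 0` (`eq_zero_of_legal_cCore`: the leaf test gives `γ_ℓ = γ_{row 0} = 0` by
private monomials, the slave at `q` gives `γ_q = 0`), so it adjoins only `0`; over ANY base pair, with `u ≠ 0` a common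
kernel vector on row `0` of the `< n` rows (`exists_cKernel`), the EXACT SLAVE CURVE `F_{(0,m)} = u_m s`,
`F_{(i+1,m)} = -F_{(i,m)}²`, `F_ℓ = 0` annihilates rows and slaves identically and pins to order `s^{2^{n-1}}`
(`cGood_jet_dvd`), and M81's jet certificate forbids isolation of every order `K < 2^{n-1}`.

Results: `not_freeReach_of_four_le : 4 ≤ D → ¬ FreeReach D r K`; `not_freeReach_four : ¬ FreeReach 4 r K`.
Reading (NEC-side, rung currency 0): the cost-free alphabet — horizontal fields and constant (indeed affine: same
monomial argument) vertical fields — has NO REACH AT ALL from degree `4` on; what a deflation engine achieves at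
`D = 4` (Theorem B of NODE-g45: two KERNEL rounds reach order `1`) is carried by vertical kernel fields genuinely
quadratic in `(a, b)`, the cost-bearing part of the alphabet.  Says nothing about `MultiplicityReduction` itself.
-/

set_option linter.dupNamespace false

noncomputable section

namespace Summit.MatrixMultiplication.MatrixMultiplication.Theorems.GraphEquations

open MvPolynomial Matrix Literature.Computability.AlgebraicComplexity Literature.Computability.AlgebraicComplexity.ArithCircuit

variable {n : ℕ}

/-- The LEAF position `ℓ = (n-1, 0)`. -/
def cLeaf (hn : 3 ≤ n) : Fin n × Fin n := (⟨n - 1, by omega⟩, ⟨0, by omega⟩)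

/-- The pinned position `(n-2, m)` of column `m`. -/
def cPinPos (hn : 3 ≤ n) (m : Fin n) : Fin n × Fin n := (⟨n - 2, by omega⟩, m)

/-- The position above `q`: `(i-1, m)` for `q = (i, m)`. -/
def cUp (q : Fin n × Fin n) : Fin n × Fin n := (⟨q.1 - 1, by omega⟩, q.2)

/-- The leaf row: `1` at the leaf, the private product `a_q b_q` on row `0`, `0` elsewhere. -/
def cTheta (hn : 3 ≤ n) (q : Fin n × Fin n) : MvPolynomial (MatMulVars n) ℂ :=
  if q = cLeaf hn then 1 else if (q.1 : ℕ) = 0 then rpTheta n q else 0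

/-- The test in the slot of position `q`: a pin (row `0`), the leaf row test (at `ℓ`), or a square slave. -/
def cTest (hn : 3 ≤ n) (q : Fin n × Fin n) : MvPolynomial (GraphVars n) ℂ :=
  if (q.1 : ℕ) = 0 then generator n (cPinPos hn q.2) ^ 2
  else if q = cLeaf hn then rowTest (cTheta hn) else generator n q + generator n (cUp q) ^ 2

/-- Row-`0` slots hold pins. -/
theorem cTest_of_fst_eq_zero (hn : 3 ≤ n) {q : Fin n × Fin n} (h : (q.1 : ℕ) = 0) :
    cTest hn q = generator n (cPinPos hn q.2) ^ 2 := by unfold cTest; rw [if_pos h]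

/-- The leaf slot holds the leaf row test. -/
theorem cTest_cLeaf (hn : 3 ≤ n) : cTest hn (cLeaf hn) = rowTest (cTheta hn) := by
  unfold cTest; rw [if_neg (by show n - 1 ≠ 0; omega), if_pos rfl]

/-- The other slots of rows `≥ 1` hold square slaves. -/
theorem cTest_slave (hn : 3 ≤ n) {q : Fin n × Fin n} (h0 : (q.1 : ℕ) ≠ 0) (hq : q ≠ cLeaf hn) :
    cTest hn q = generator n q + generator n (cUp q) ^ 2 := by unfold cTest; rw [if_neg h0, if_neg hq]

/-- Off row `0` and off the leaf, the leaf row vanishes. -/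
theorem cTheta_eq_zero (hn : 3 ≤ n) {q : Fin n × Fin n} (h0 : (q.1 : ℕ) ≠ 0) (hq : q ≠ cLeaf hn) :
    cTheta hn q = 0 := by unfold cTheta; rw [if_neg hq, if_neg h0]

/-- Positions of row `≤ n - 2` are not the leaf. -/
theorem ne_cLeaf_of_le (hn : 3 ≤ n) {q : Fin n × Fin n} (hq : (q.1 : ℕ) ≤ n - 2) : q ≠ cLeaf hn := fun h => by
  have : (q.1 : ℕ) = n - 1 := by rw [h]; rfl
  omega

/-- **CORRECTNESS OF `CS_n`**: if every slot test vanishes at a point, so does every generator. -/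
theorem eval_generator_eq_zero_of_cTest (hn : 3 ≤ n) (x : GraphVars n → ℂ)
    (H : ∀ q, MvPolynomial.eval x (cTest hn q) = 0) (q : Fin n × Fin n) : MvPolynomial.eval x (generator n q) = 0 := by
  have hdown : ∀ k : ℕ, ∀ q : Fin n × Fin n, (q.1 : ℕ) + k = n - 2 → MvPolynomial.eval x (generator n q) = 0 := by
    intro k
    induction k with | zero => ?_ | succ k ih => ?_ <;> intro q hq
    · have h := H (⟨0, by omega⟩, q.2)
      rw [cTest_of_fst_eq_zero hn rfl, map_pow, show cPinPos hn q.2 = q from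
        Prod.ext (Fin.ext (by simp only [cPinPos]; omega)) rfl] at h
      exact pow_eq_zero_iff two_ne_zero |>.1 h
    · let q' : Fin n × Fin n := (⟨q.1 + 1, by omega⟩, q.2)
      have hq' : MvPolynomial.eval x (generator n q') = 0 := ih q' (by dsimp [q']; omega)
      have h := H q'
      rw [cTest_slave hn (q := q') (by dsimp [q']; omega) (ne_cLeaf_of_le hn (by dsimp [q']; omega)),
        map_add, map_pow, hq', zero_add] at h
      have hup : cUp q' = q := Prod.ext (Fin.ext (by simp [cUp, q'])) rfl
      rw [← hup]; exact pow_eq_zero_iff two_ne_zero |>.1 h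
  have hle : ∀ q : Fin n × Fin n, (q.1 : ℕ) ≤ n - 2 → MvPolynomial.eval x (generator n q) = 0 :=
    fun q hq => hdown (n - 2 - q.1) q (by omega)
  by_cases hq : (q.1 : ℕ) ≤ n - 2
  · exact hle q hq
  by_cases hℓ : q = cLeaf hn
  · have h := H (cLeaf hn)
    rw [cTest_cLeaf, rowTest, map_sum, Finset.sum_eq_single (cLeaf hn)] at h
    · rw [hℓ]; simpa [cTheta] using h
    · intro q' _ hq'
      by_cases h0 : (q'.1 : ℕ) = 0
      · rw [map_mul, hle q' (by omega), mul_zero]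
      · rw [cTheta_eq_zero hn h0 hq', map_zero, zero_mul, map_zero]
    · exact fun h => (h (Finset.mem_univ _)).elim
  · have h := H q
    rw [cTest_slave hn (by omega) hℓ, map_add, map_pow, hle (cUp q) (by dsimp [cUp]; omega)] at h
    simpa using h

/-- On the graph every slot test vanishes. -/
theorem eval_cTest_eq_zero (hn : 3 ≤ n) {x : GraphVars n → ℂ} (hg : ∀ q, MvPolynomial.eval x (generator n q) = 0)
    (q : Fin n × Fin n) : MvPolynomial.eval x (cTest hn q) = 0 := by
  unfold cTest
  split_ifs
  · rw [map_pow, hg, zero_pow two_ne_zero]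
  · rw [rowTest, map_sum]
    exact Finset.sum_eq_zero fun q _ => by rw [map_mul, hg q, mul_zero]
  · rw [map_add, map_pow, hg, hg, zero_pow two_ne_zero, add_zero]

/-- The leaf row has coefficients of degree `≤ 2`. -/
theorem totalDegree_liftAB_cTheta_le (hn : 3 ≤ n) (q : Fin n × Fin n) : (liftAB n (cTheta hn q)).totalDegree ≤ 2 := by
  unfold cTheta; split_ifs
  · simp
  · rw [rpTheta, map_mul, liftAB_X, liftAB_X]
    exact (totalDegree_mul _ _).trans (add_le_add (totalDegree_X (R := ℂ) _).le (totalDegree_X (R := ℂ) _).le)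
  · simp

/-- Every slot test has degree `≤ 4`. -/
theorem totalDegree_cTest_le (hn : 3 ≤ n) (q : Fin n × Fin n) : (cTest hn q).totalDegree ≤ 4 := by
  have hg := totalDegree_generator_le_two n
  unfold cTest
  split_ifs with h0 hq
  · exact (totalDegree_pow _ _).trans (by have := hg (cPinPos hn q.2); nlinarith)
  · refine (totalDegree_finsetSum _ _).trans (Finset.sup_le fun q' _ => (totalDegree_mul _ _).trans ?_)
    have h1 := totalDegree_liftAB_cTheta_le hn q'
    have h2 := hg q'
    omega
  · refine (totalDegree_add _ _).trans (max_le ((hg q).trans (by norm_num)) ?_)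
    exact (totalDegree_pow _ _).trans (by have := hg (cUp q); nlinarith)

/-- The CONSTANT-COEFFICIENT part of the specimen: `0` and the non-leaf slot tests (slaves and pins). -/
def cBase (hn : 3 ≤ n) : Set (MvPolynomial (GraphVars n) ℂ) := {t | t = 0 ∨ ∃ q, q ≠ cLeaf hn ∧ t = cTest hn q}

/-- The SHAPE of every element of a free stage over `CS_n`: constant part, or a row test whose row lies in `R` and
is SUPPORTED on row `0` and the leaf. -/
def CGood (hn : 3 ≤ n) (R : List (Fin n × Fin n → MvPolynomial (MatMulVars n) ℂ)) :
    Set (MvPolynomial (GraphVars n) ℂ) :=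
  {t | t ∈ cBase hn ∨ ∃ ρ ∈ R, (∀ q, (q.1 : ℕ) ≠ 0 → q ≠ cLeaf hn → ρ q = 0) ∧ t = rowTest ρ}

/-- The CORE of the specimen: the slot tests of rows `≥ 1` (slaves and the leaf test). -/
def cCore (hn : 3 ≤ n) : Set (MvPolynomial (GraphVars n) ℂ) := {t | ∃ q, (q.1 : ℕ) ≠ 0 ∧ t = cTest hn q}

/-- Horizontal letters kill the constant part. -/
theorem hDer_eq_zero_of_mem_cBase (hn : 3 ≤ n) (U W : Vec n) {t : MvPolynomial (GraphVars n) ℂ} (ht : t ∈ cBase hn) :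
    hDer U W t = 0 := by
  rcases ht with rfl | ⟨q, hq, rfl⟩
  · exact map_zero _
  · by_cases h0 : (q.1 : ℕ) = 0
    · rw [cTest_of_fst_eq_zero hn h0, hDer_generator_pow]
    · rw [cTest_slave hn h0 hq, map_add, hDer_generator, hDer_generator_pow, add_zero]

/-- `Σ_q γ_q θ'_q = 0` with CONSTANT `γ` forces `γ_ℓ = 0` (constant term) and `γ_{row 0} = 0` (`a = δ_p`, `b ≡ 1`). -/
theorem eq_zero_of_sum_cTheta (hn : 3 ≤ n) (γ : Vec n) (h : ∑ q, C (γ q) * cTheta hn q = 0) :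
    γ (cLeaf hn) = 0 ∧ ∀ p : Fin n × Fin n, (p.1 : ℕ) = 0 → γ p = 0 := by
  classical
  have hℓ : γ (cLeaf hn) = 0 := by
    simpa [cTheta, rpTheta, mul_ite, apply_ite constantCoeff, Finset.sum_ite_eq'] using congr_arg constantCoeff h
  refine ⟨hℓ, fun p hp => ?_⟩
  have hpℓ : p ≠ cLeaf hn := ne_cLeaf_of_le hn (by omega)
  have h' := congr_arg (MvPolynomial.eval (Sum.elim (fun q' => if q' = p then (1 : ℂ) else 0) fun _ => (1 : ℂ))) h
  rw [map_sum, Finset.sum_eq_single p, map_zero] at h'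
  · simpa [cTheta, hpℓ, hp, rpTheta] using h'
  · intro q _ hqp
    by_cases hqℓ : q = cLeaf hn
    · rw [hqℓ, map_mul, eval_C, hℓ, zero_mul]
    by_cases h0 : (q.1 : ℕ) = 0
    · simp [cTheta, hqℓ, h0, rpTheta, hqp]
    · simp [cTheta_eq_zero hn h0 hqℓ]
  · exact fun h => (h (Finset.mem_univ _)).elim

/-- **A CONSTANT VERTICAL LETTER LEGAL ON THE CORE IS ZERO** — `CS_n` has no constant kernel field at any free stage. -/
theorem eq_zero_of_legal_cCore (hn : 3 ≤ n) {γ : Vec n} {S : Set (MvPolynomial (GraphVars n) ℂ)} (hS : cCore hn ⊆ S)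
    (hl : ∀ t ∈ S, derivC (constField γ) t ∈ graphIdeal n) : γ = 0 := by
  have hℓS : rowTest (cTheta hn) ∈ S := hS ⟨cLeaf hn, by show n - 1 ≠ 0; omega, (cTest_cLeaf hn).symm⟩
  have hsum : ∑ q, C (γ q) * cTheta hn q = 0 := by
    have h := hl _ hℓS
    rw [derivC_rowTest, liftAB_mem_graphIdeal_iff] at h
    simpa only [constField] using h
  funext q
  show γ q = 0
  by_cases h0 : (q.1 : ℕ) = 0
  · exact (eq_zero_of_sum_cTheta hn γ hsum).2 q h0
  by_cases hq : q = cLeaf hn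
  · rw [hq]; exact (eq_zero_of_sum_cTheta hn γ hsum).1
  have h := hl _ (hS ⟨q, h0, rfl⟩)
  rw [cTest_slave hn h0 hq, derivC_add, derivC_generator, pow_two, derivC_mul] at h
  have hI : derivC (constField γ) (generator n (cUp q)) * generator n (cUp q) +
      generator n (cUp q) * derivC (constField γ) (generator n (cUp q)) ∈ graphIdeal n :=
    (graphIdeal n).add_mem ((graphIdeal n).mul_mem_left _ (generator_mem_graphIdeal _))
      ((graphIdeal n).mul_mem_right _ (generator_mem_graphIdeal _))
  have h1 : liftAB n (constField γ q) ∈ graphIdeal n := by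
    have h2 := (graphIdeal n).sub_mem h hI
    rwa [add_sub_cancel_right] at h2
  rw [liftAB_mem_graphIdeal_iff, constField, C_eq_zero] at h1
  exact h1

/-- **THE FREE-STAGE INVARIANT OF `CS_n`**: along any free tower over a stage containing the core and of shape
`CGood R`, every stage has shape `CGood R'` with `|R'| ≤ 2^{length} · |R|`. -/
theorem freeTowerSet_subset_cGood (hn : 3 ≤ n) :
    ∀ (w : List (FreeLetter n)) (S : Set (MvPolynomial (GraphVars n) ℂ))
      (R : List (Fin n × Fin n → MvPolynomial (MatMulVars n) ℂ)), cCore hn ⊆ S → S ⊆ CGood hn R → IsFreeTower S w →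
        ∃ R' : List (Fin n × Fin n → MvPolynomial (MatMulVars n) ℂ),
          R'.length ≤ 2 ^ w.length * R.length ∧ freeTowerSet S w ⊆ CGood hn R'
  | [], S, R, _, hS, _ => ⟨R, by simp, hS⟩
  | FreeLetter.H U W :: w, S, R, hC, hS, hT => by
    have hS₁ : S ∪ (FreeLetter.H U W).image S ⊆ CGood hn (R ++ R.map fun ρ q => bDer U W (ρ q)) := by
      rintro t (ht | ⟨t, ht, rfl⟩)
      · rcases hS ht with hb | ⟨ρ, hρ, hρ0, hρt⟩
        · exact Or.inl hb
        · exact Or.inr ⟨ρ, List.mem_append_left _ hρ, hρ0, hρt⟩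
      · rcases hS ht with hb | ⟨ρ, hρ, hρ0, rfl⟩
        · exact Or.inl (Or.inl (hDer_eq_zero_of_mem_cBase hn U W hb))
        · exact Or.inr ⟨fun q => bDer U W (ρ q), List.mem_append_right _ (List.mem_map.2 ⟨ρ, hρ, rfl⟩),
            fun q h0 hq => by simp only [hρ0 q h0 hq, map_zero], hDer_rowTest U W ρ⟩
    obtain ⟨R', hlen, hsub⟩ := freeTowerSet_subset_cGood hn w _ _ (fun t ht => Or.inl (hC ht)) hS₁ hT.2
    refine ⟨R', hlen.trans ?_, hsub⟩
    rw [List.length_append, List.length_map, List.length_cons, pow_succ]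
    linarith
  | FreeLetter.V γ :: w, S, R, hC, hS, hT => by
    have hS₁ : S ∪ (FreeLetter.V γ).image S ⊆ CGood hn R := by
      rintro t (ht | ⟨t, -, rfl⟩)
      · exact hS ht
      · rw [eq_zero_of_legal_cCore hn hC hT.1]; exact Or.inl (Or.inl (derivC_constField_zero t))
    obtain ⟨R', hlen, hsub⟩ := freeTowerSet_subset_cGood hn w _ R (fun t ht => Or.inl (hC ht)) hS₁ hT.2
    refine ⟨R', hlen.trans ?_, hsub⟩
    rw [List.length_cons, pow_succ]
    have : 0 ≤ 2 ^ w.length * R.length := Nat.zero_le _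
    nlinarith

/-- Fewer than `n` rows have, at every base pair, a common kernel vector `u ≠ 0` supported on row `0`. -/
theorem exists_cKernel (hn : 3 ≤ n) (y : MatMulVars n → ℂ) (R : List (Fin n × Fin n → MvPolynomial (MatMulVars n) ℂ))
    (hR : R.length < n) :
    ∃ u : Fin n × Fin n → ℂ, u ≠ 0 ∧ (∀ q, (q.1 : ℕ) ≠ 0 → u q = 0) ∧
      ∀ ρ ∈ R, ∑ q, MvPolynomial.eval y (ρ q) * u q = 0 := by
  classical
  let r0 : Fin n := ⟨0, by omega⟩
  let M : Matrix (Fin R.length) (Fin n) ℂ := Matrix.of fun i m => MvPolynomial.eval y (R.get i (r0, m))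
  have hlt : Module.finrank ℂ (Fin R.length → ℂ) < Module.finrank ℂ (Fin n → ℂ) := by
    simpa only [Module.finrank_fintype_fun_eq_card, Fintype.card_fin] using hR
  obtain ⟨v, hv, hv0⟩ := Submodule.exists_mem_ne_zero_of_ne_bot (LinearMap.ker_ne_bot_of_finrank_lt (f := M.mulVecLin) hlt)
  obtain ⟨m, hm⟩ := Function.ne_iff.1 hv0
  refine ⟨fun q => if (q.1 : ℕ) = 0 then v q.2 else 0, Function.ne_iff.2 ⟨(r0, m), by simpa [r0] using hm⟩,
    fun q h0 => if_neg h0, fun ρ hρ => ?_⟩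
  obtain ⟨i, rfl⟩ := List.get_of_mem hρ
  have h := congr_fun (LinearMap.mem_ker.1 hv) i
  rw [Fintype.sum_prod_type, Finset.sum_eq_single r0]
  · simpa [M, Matrix.mulVec, dotProduct, r0] using h
  · intro i' _ hi'
    have hi0 : ¬((i' : ℕ) = 0) := fun h => hi' (Fin.ext h)
    exact Finset.sum_eq_zero fun m' _ => by simp [hi0]
  · exact fun h => (h (Finset.mem_univ _)).elim

/-- The slave recursion `c_0 = z`, `c_{i+1} = -c_i²` (the coefficient of row `i` along the slave curve). -/
def cJc : ℕ → ℂ → ℂ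
  | 0, z => z
  | i + 1, z => -(cJc i z) ^ 2

/-- Row `i` of the slave curve with master value `z`: `c_i(z) · s^{2^i}`. -/
def cJetAux (i : ℕ) (z : ℂ) : Polynomial ℂ := Polynomial.C (cJc i z) * Polynomial.X ^ 2 ^ i

/-- Squaring a row of the slave curve doubles the order. -/
theorem cJetAux_sq (i : ℕ) (z : ℂ) : cJetAux i z ^ 2 = Polynomial.C (cJc i z ^ 2) * Polynomial.X ^ 2 ^ (i + 1) := by
  rw [cJetAux, mul_pow, ← Polynomial.C_pow, ← pow_mul, ← pow_succ]

/-- **THE SLAVE RELATION HOLDS EXACTLY along the curve**: `F_{i+1} + F_i² = 0`. -/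
theorem cJetAux_succ_add_sq (i : ℕ) (z : ℂ) : cJetAux (i + 1) z + cJetAux i z ^ 2 = 0 := by
  rw [cJetAux_sq, cJetAux, cJc, ← add_mul, ← Polynomial.C_add, neg_add_cancel, Polynomial.C_0, zero_mul]

/-- The EXACT SLAVE CURVE through the origin of the fibre: `F_{(i,m)} = c_i(u_{(0,m)}) s^{2^i}`, `F_ℓ = 0`. -/
def cJet (hn : 3 ≤ n) (u : Fin n × Fin n → ℂ) (q : Fin n × Fin n) : Polynomial ℂ :=
  if q = cLeaf hn then 0 else cJetAux q.1 (u (⟨0, by omega⟩, q.2))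

/-- The slave curve off the leaf. -/
theorem cJet_of_ne (hn : 3 ≤ n) (u : Fin n × Fin n → ℂ) {q : Fin n × Fin n} (hq : q ≠ cLeaf hn) :
    cJet hn u q = cJetAux q.1 (u (⟨0, by omega⟩, q.2)) := if_neg hq

/-- The slave curve passes through the origin. -/
theorem cJet_coeff_zero (hn : 3 ≤ n) (u : Fin n × Fin n → ℂ) (q : Fin n × Fin n) : (cJet hn u q).coeff 0 = 0 := by
  unfold cJet cJetAux; split_ifs; exacts [rfl, by rw [Polynomial.coeff_C_mul_X_pow, if_neg (by positivity)]]

/-- **ALONG THE SLAVE CURVE every element of `CGood R` is `O(s^{2^{n-1}})`**: slaves and row tests vanish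
identically (kernel vector on row `0`, rows supported on row `0` and the leaf, `F_ℓ = 0`), pins to order `2^{n-1}`. -/
theorem cGood_jet_dvd (hn : 3 ≤ n) (y : MatMulVars n → ℂ) (u : Fin n × Fin n → ℂ)
    (hu : ∀ q, (q.1 : ℕ) ≠ 0 → u q = 0) (R : List (Fin n × Fin n → MvPolynomial (MatMulVars n) ℂ))
    (hker : ∀ ρ ∈ R, ∑ q, MvPolynomial.eval y (ρ q) * u q = 0) {t} (ht : t ∈ CGood hn R) :
    Polynomial.X ^ 2 ^ (n - 1) ∣ aeval (cJet hn u) (MvPolynomial.map (MvPolynomial.eval y) (liftF n t)) := by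
  rcases ht with (rfl | ⟨q, hq, rfl⟩) | ⟨ρ, hρ, hρ0, rfl⟩
  · simp
  · by_cases h0 : (q.1 : ℕ) = 0
    · have hpne : cPinPos hn q.2 ≠ cLeaf hn := ne_cLeaf_of_le hn (by simp [cPinPos])
      rw [cTest_of_fst_eq_zero hn h0, map_pow, liftF_generator, map_pow, map_X, map_pow, aeval_X, cJet_of_ne hn u hpne,
        show ((cPinPos hn q.2).1 : ℕ) = n - 2 from rfl, cJetAux_sq, show n - 2 + 1 = n - 1 by omega]
      exact dvd_mul_left _ _
    · refine ⟨0, ?_⟩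
      obtain ⟨k, hk⟩ : ∃ k : ℕ, (q.1 : ℕ) = k + 1 := ⟨q.1 - 1, by omega⟩
      have hupne : cUp q ≠ cLeaf hn := ne_cLeaf_of_le hn (by simp only [cUp]; omega)
      rw [mul_zero, cTest_slave hn h0 hq, map_add, map_pow, liftF_generator, liftF_generator, map_add, map_pow, map_X,
        map_X, map_add, map_pow, aeval_X, aeval_X, cJet_of_ne hn u hq, cJet_of_ne hn u hupne,
        show ((cUp q).1 : ℕ) = (q.1 : ℕ) - 1 from rfl, show (cUp q).2 = q.2 from rfl, hk, Nat.add_sub_cancel]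
      exact cJetAux_succ_add_sq k _
  · refine ⟨0, ?_⟩
    rw [mul_zero, liftF_rowTest, map_sum, map_sum]
    simp only [map_mul, map_C, map_X, aeval_C, aeval_X, Polynomial.algebraMap_eq]
    have hterm : ∀ q, Polynomial.C (MvPolynomial.eval y (ρ q)) * cJet hn u q =
        Polynomial.C (MvPolynomial.eval y (ρ q) * u q) * Polynomial.X := by
      intro q
      by_cases hqℓ : q = cLeaf hn
      · rw [cJet, if_pos hqℓ, hu q (by rw [hqℓ]; show n - 1 ≠ 0; omega)]; simp
      by_cases h0 : (q.1 : ℕ) = 0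
      · have hq0 : ((⟨0, by omega⟩ : Fin n), q.2) = q := Prod.ext (Fin.ext h0.symm) rfl
        rw [cJet_of_ne hn u hqℓ, h0, cJetAux, cJc, pow_zero, pow_one, hq0, map_mul, mul_assoc]
      · rw [hρ0 q h0 hqℓ, hu q h0]; simp
    calc ∑ q, Polynomial.C (MvPolynomial.eval y (ρ q)) * cJet hn u q
        = Polynomial.C (∑ q, MvPolynomial.eval y (ρ q) * u q) * Polynomial.X := by
          rw [map_sum, Finset.sum_mul]; exact Finset.sum_congr rfl fun q _ => hterm q
      _ = 0 := by rw [hker ρ hρ, map_zero, zero_mul]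

/-- **NO FREE STAGE OF SHAPE `CGood R` WITH `|R| < n` IS ISOLATED TO ANY ORDER `K < 2^{n-1}`.** -/
theorem not_idealInitIsolatedSet_cGood (hn : 3 ≤ n) {K : ℕ} (hK : K < 2 ^ (n - 1))
    {R : List (Fin n × Fin n → MvPolynomial (MatMulVars n) ℂ)} (hRlen : R.length < n)
    {S : Set (MvPolynomial (GraphVars n) ℂ)} (hS : S ⊆ CGood hn R) (y : MatMulVars n → ℂ) :
    ¬ IdealInitIsolatedSet S K y := by
  obtain ⟨u, hu0, hu, hker⟩ := exists_cKernel hn y R hRlen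
  refine not_idealInitIsolatedSet_of_jetCert (cJet hn u) (cJet_coeff_zero hn u) hK
    (fun t ht => cGood_jet_dvd hn y u hu R hker (hS ht)) fun h => hu0 (funext fun q => ?_)
  show u q = 0
  by_cases h0 : (q.1 : ℕ) = 0
  · have hq : q ≠ cLeaf hn := ne_cLeaf_of_le hn (by omega)
    have hq0 : ((⟨0, by omega⟩ : Fin n), q.2) = q := Prod.ext (Fin.ext h0.symm) rfl
    have h1 : (cJet hn u q).coeff 1 = 0 := congr_fun h q
    rwa [cJet_of_ne hn u hq, h0, cJetAux, cJc, pow_zero, pow_one, hq0, Polynomial.coeff_C_mul_X] at h1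
  · exact hu q h0

/-- **`CS_n` REALISED** (`n ≥ 3`, `D ≥ 4`): a correct system of degree `≤ D`, tests `⊇` core, of shape `CGood [θ']`. -/
theorem exists_cSystem (hn : 3 ≤ n) {D : ℕ} (hD : 4 ≤ D) : ∃ E : EqSystem n, E.Correct ∧ E.IsDegLe D ∧
    cCore hn ⊆ E.testSet ∧ E.testSet ⊆ CGood hn [cTheta hn] := by
  classical
  obtain ⟨E, hfan, hto, hfrom⟩ :=
    exists_realisation_list ((Finset.univ : Finset (Fin n × Fin n)).toList.map (cTest hn))
  have hto' : ∀ j ∈ E.tests, ∃ q, cTest hn q = E.testPoly j := fun j hj => by simpa using hto j hj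
  have hfrom' : ∀ q, ∃ j ∈ E.tests, E.testPoly j = cTest hn q := fun q => hfrom _ (by simp)
  refine ⟨E, ⟨hfan, Set.ext fun x => ⟨fun hx => ?_, fun hx j hj => ?_⟩⟩, fun o => ?_, ?_, ?_⟩
  · refine (mem_mmGraph_iff_eval_generator x).2 (eval_generator_eq_zero_of_cTest hn x fun q => ?_)
    obtain ⟨j, hj, hjq⟩ := hfrom' q
    rw [← hjq]; exact hx j hj
  · obtain ⟨q, hq⟩ := hto' j hj
    rw [← hq]; exact eval_cTest_eq_zero hn ((mem_mmGraph_iff_eval_generator x).1 hx) q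
  · obtain ⟨q, hq⟩ := hto' _ (List.get_mem _ o)
    rw [← hq]; exact (totalDegree_cTest_le hn q).trans hD
  · rintro t ⟨q, -, rfl⟩
    exact (E.mem_testSet_iff _).2 (hfrom' q)
  · intro t ht
    obtain ⟨j, hj, rfl⟩ := (E.mem_testSet_iff t).1 ht
    obtain ⟨q, hq⟩ := hto' j hj
    by_cases hqℓ : q = cLeaf hn
    · rw [← hq, hqℓ, cTest_cLeaf]
      exact Or.inr ⟨cTheta hn, List.mem_singleton.2 rfl, fun _ h0 hq => cTheta_eq_zero hn h0 hq, rfl⟩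
    · exact Or.inl (Or.inr ⟨q, hqℓ, hq.symm⟩)

/-- **THE FREE DIAL COLLAPSES**: for every `D ≥ 4`, `r`, `K`, `FreeReach D r K` fails — over `n = 2^r + K + 3` every
free stage of `CS_n` after a word of length `≤ r` has shape `CGood R'`, `|R'| ≤ 2^r < n`, and `K < 2^{n-1}`. -/
theorem not_freeReach_of_four_le {D : ℕ} (hD : 4 ≤ D) (r K : ℕ) : ¬ FreeReach D r K := by
  intro h
  have hn : 3 ≤ 2 ^ r + K + 3 := Nat.le_add_left 3 _
  obtain ⟨E, hE, hdeg, hcore, hgood⟩ := exists_cSystem hn hD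
  obtain ⟨w, hlen, hT, y, hy⟩ := h (2 ^ r + K + 3) ((by norm_num : (1 : ℕ) ≤ 3).trans (Nat.le_add_left 3 _)) E hE hdeg
  obtain ⟨R', hR', hsub⟩ := freeTowerSet_subset_cGood hn w E.testSet [cTheta hn] hcore hgood hT
  have hR'lt : R'.length < 2 ^ r + K + 3 := by
    have h1 : 2 ^ w.length ≤ 2 ^ r := Nat.pow_le_pow_right (by norm_num) hlen
    have h2 : R'.length ≤ 2 ^ r := by simpa using hR'.trans (by simpa using h1)
    exact h2.trans_lt ((Nat.le_add_right _ K).trans_lt (Nat.lt_add_of_pos_right (by norm_num)))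
  have hK : K < 2 ^ (2 ^ r + K + 3 - 1) := by
    refine lt_trans ?_ Nat.lt_two_pow_self
    rw [show 2 ^ r + K + 3 - 1 = 2 ^ r + K + 2 from rfl]
    exact (Nat.le_add_left K _).trans_lt (Nat.lt_add_of_pos_right (by norm_num))
  exact not_idealInitIsolatedSet_cGood hn hK hR'lt hsub y hy

/-- **`D = 4`: `¬ FreeReach 4 r K` for every `r` and `K`** — the table of NODE-g49 §3.3 / M84 has no open cell. -/
theorem not_freeReach_four (r K : ℕ) : ¬ FreeReach 4 r K := not_freeReach_of_four_le le_rfl r K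

end Summit.MatrixMultiplication.MatrixMultiplication.Theorems.GraphEquations
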